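import Summits.QuantumFields.BalabanUV.T4Continuum.Support.NE7FlatSliceEnd
import Summits.QuantumFields.BalabanUV.T4Continuum.Support.NE7OneStepOfPathOpen
import HarnessLib

/-!
# NE7RoadBLettersFlatWitness — NON-VACUITY OF ROAD (B)'s REMAINING LETTERS AT THE FLAT BACKGROUND: the slice-solver letter (L2) in EXACTLY the shape F78∕F115∕F123d consume
# (`S` = the skew fields, `K_G = K·L^{j+1}`) follows from lineage #2's (152) `NE7FlatSliceEnd.sliceSolver_end_holds`; the tangent-criticality letters and the flux-gradient radius
# `g = 0` hold at `flatCfg` — so F123d's hypothesis set is inhabited (at the trivial datum, where the (APE) itself is D8 `NE7ApeTrivialFlatEndCritical`); file 55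

Cell `pub-balaban`, rung (B)+1 sub-cell t4, lineage `b2b-balaban-t4-ne7-p1` (CRUX PROVER NE7 #1 = OWNER of row NE7), generation 79; memo `t4/b2b-balaban-t4-ne7-p1-g79/GRADIENT-LETTER.md` §7.
File F124 (over (152) `NE7FlatSliceEnd.sliceSolver_end_holds` [lineage #2 g84; [Balaban1984PropagatorsI] (1.103)∕(1.115) via lit-balaban ∕ GAN24], `NE7OneStepOfPathOpen.dAction_flatCfg`,
`MinimalActionWitness` (`flatCfg`, `flux_flatCfg`), `NE3TangentFlatPush.flatCfg_eq_flat`).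
WHY.  After F123d the curved (APE) with a datum on road (B) displays ONE analytic letter, (L2) `hG`, quantified as `∀ X ∈ S` (`S ⊇` the `W`-tangent skew periodic fields) with the
period written `(N·L^{j+1} : ℕ)` and a free constant `K_G`.  (152) proves the flat letter with `X` SKEW, period `(L^{k+1}·N : ℕ)`, background `BlockAveragePushDirSplit.flat`,
dimension `d+1`, constant `K·L^{k+1}`.  THIS file checks the shapes meet: `S := {X | IsSkewDir X}` satisfies F115's `hS`, `Nat.mul_comm` aligns the period, `flatCfg = flat` by `rfl`,
`d ≥ 2 ⇒ d = d′+1` — so at `W = 1` the letter is a THEOREM with `K_G = K·M` (the currency `K_G ≍ M` of memo §1∕§4).  Together with `dAction flatCfg Y = 0` (tangent-criticality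
at flat) and `covGrad flatCfg (flux flatCfg) = 0` (flux-gradient radius `0`), and since every regime line of F123d reads `0 ≤ c` at zero radii, F123d's hypotheses are jointly
satisfiable — the statement is not vacuous.  (The flat (APE) itself is D8; the CURVED (L2) is [Balaban1985PropagatorsII] material, memo §7.)
WHAT ([folklore]; 0 def, 0 sorry).  §1 **`sliceSolver_letter_flatCfg`**, `skew_slice_contains_tangent` (F115's `hS` for `S = {skew}`).  §2 `tanCritical_letter_flatCfg`.  §3
`fluxGrad_radius_flatCfg`.
HONEST FRAMING (page 1): shape bookkeeping over landed theorems; nothing of Bałaban's asserted beyond what (152) cites; the CURVED (L2) is NOT touched; NOT ONE-STEP, NOT NE7; spine 0∕9;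
finite T⁴ rung (B)+1 — NOT infinite volume, NOT mass gap, NOT `BetaPertH`, NOT Clay.  Continuum YM on T⁴ ⇐ BetaPertH ∧ nine spine estimates (0/9 proved); BetaPertH ⇐ (D1) ∧ (D4) ∧
CAP+tail; G-an2-4 gates asym, D1 and NE2/3/4.
-/

set_option autoImplicit false

open scoped BigOperators Matrix Matrix.Norms.L2Operator
open NormedSpace Finset

namespace Summit.QuantumFields.BalabanUV.T4Continuum.NE7RoadBLettersFlatWitness

open Literature.MathematicalPhysics.QuantumFieldTheory.Balaban1983to89
open B7Prop1Explicit B7Prop2Explicit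
open T4AveragingDeficitWall (Ad IsUnitaryCfg IsSkewDir SmallField curlAt dirL1 covGrad flux)
open T4AveragingDeficitWallBoundary (IsPeriodicCfg periodBox)
open AveragingDeficitPeriodicCounting (IsPeriodicDir)
open MinimalActionLevels (perWin)
open MinimalActionWitness (flatCfg flux_flatCfg)
open NE3HessForm (hess dAction)
open NE3TangentCovariantTower (dirIter)
open NE7FlatSliceEnd (sliceSolver_end_holds)
open NE7OneStepOfPathOpen (dAction_flatCfg)

noncomputable section

variable {d : ℕ} {n : Type} [Fintype n] [DecidableEq n]

/-! ## §1 The slice-solver letter (L2) at the flat background, in road (B)'s shape -/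

/-- F115's slice hypothesis `hS` for the choice `S = {skew fields}`: every `W`-tangent skew periodic field is in `S`. [folklore] -/
theorem skew_slice_contains_tangent {L N j : ℕ} (W : Site d → Fin d → (Matrix n n ℂ)ˣ) :
    ∀ X : Site d → Fin d → Matrix n n ℂ, IsSkewDir X → IsPeriodicDir X ((N * L ^ (j + 1) : ℕ) : ℤ) → dirIter L (j + 1) W X = 0 →
      X ∈ {X : Site d → Fin d → Matrix n n ℂ | IsSkewDir X} :=
  fun _ hX _ _ => hX

/-- **(L2) AT THE FLAT BACKGROUND IN ROAD (B)'s SHAPE**: for `d ≥ 2`, `L ≥ 2` there is `K ≥ 0` (free of `N`, `j`) such that for every `N ≥ 1`, `j`, with `S = {skew fields}` and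
`K_G = K·L^{j+1}`, F115's `hG` holds at `W = flatCfg`. [folklore] -/
theorem sliceSolver_letter_flatCfg [Nonempty n] (hd : 2 ≤ d) {L : ℕ} (hL : 2 ≤ L) :
    ∃ K : ℝ, 0 ≤ K ∧ ∀ (N : ℕ) [NeZero N] (j : ℕ),
      ∀ X ∈ {X : Site d → Fin d → Matrix n n ℂ | IsSkewDir X}, IsPeriodicDir X ((N * L ^ (j + 1) : ℕ) : ℤ) →
        dirIter L (j + 1) (flatCfg : Site d → Fin d → (Matrix n n ℂ)ˣ) X = 0 → ∀ g : ℝ, 0 ≤ g →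
        (∀ Y : Site d → Fin d → Matrix n n ℂ, IsSkewDir Y → IsPeriodicDir Y ((N * L ^ (j + 1) : ℕ) : ℤ) →
          dirIter L (j + 1) (flatCfg : Site d → Fin d → (Matrix n n ℂ)ˣ) Y = 0 →
          |hess (flatCfg : Site d → Fin d → (Matrix n n ℂ)ˣ) X Y (perWin d (N * L ^ (j + 1)))| ≤ g * dirL1 Y (periodBox (d := d) (N * L ^ (j + 1)))) →
        ∀ (z : Site d) (μ' ν' : Fin d), μ' ≠ ν' →
          ‖curlAt (flatCfg : Site d → Fin d → (Matrix n n ℂ)ˣ) X z μ' ν'‖ ≤ (K * (L : ℝ) ^ (j + 1)) * g := by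
  obtain ⟨d', rfl⟩ : ∃ d', d = d' + 1 := ⟨d - 1, by omega⟩
  obtain ⟨K, hK, h⟩ := sliceSolver_end_holds (n := n) d' (by omega) hL
  refine ⟨K, hK, fun N _ j X hX hXP hX0 g hg hH z μ' ν' hne => ?_⟩
  have hper : (L ^ (j + 1) * N : ℕ) = N * L ^ (j + 1) := Nat.mul_comm _ _
  have h' := h N j
  rw [hper] at h'
  exact h' X hX hXP hX0 g hg hH z μ' ν' hne

/-! ## §2 Tangent-criticality at the flat background -/

/-- F115's `hcritW`∕`hcritU` at `flatCfg`: the flat configuration is critical on every skew direction (tangent or not). [folklore] -/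
theorem tanCritical_letter_flatCfg [Nonempty n] (L N j : ℕ) :
    ∀ Y : Site d → Fin d → Matrix n n ℂ, IsSkewDir Y → IsPeriodicDir Y ((N * L ^ (j + 1) : ℕ) : ℤ) →
      dirIter L (j + 1) (flatCfg : Site d → Fin d → (Matrix n n ℂ)ˣ) Y = 0 →
      dAction (flatCfg : Site d → Fin d → (Matrix n n ℂ)ˣ) Y (perWin d (N * L ^ (j + 1))) = 0 :=
  fun _ hY _ _ => dAction_flatCfg hY _

/-! ## §3 The flux-gradient radius of the flat background -/

/-- F123d's `hgW`∕`hgU` at `flatCfg` with `g = 0`: the flux of the flat configuration vanishes, hence so does its covariant gradient. [folklore] -/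
theorem fluxGrad_radius_flatCfg (z : Site d) (μ : Fin d) (π : T4AveragingDeficitWall.Plane d) :
    ‖covGrad (flatCfg : Site d → Fin d → (Matrix n n ℂ)ˣ) (flux flatCfg) z μ π‖ ≤ 0 := by
  have h : covGrad (flatCfg : Site d → Fin d → (Matrix n n ℂ)ˣ) (flux flatCfg) z μ π = 0 := by
    unfold covGrad Ad
    simp only [flux_flatCfg, mul_zero, zero_mul, sub_zero]
  rw [h, norm_zero]

end

end Summit.QuantumFields.BalabanUV.T4Continuum.NE7RoadBLettersFlatWitness
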